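import Summits.CriticalPhenomena.PercolationContinuityZ3.Theorems.PercNearOneGluingNoHeavyLowerTailSahiE3HitSlotCertificate
import Summits.CriticalPhenomena.PercolationContinuityZ3.Theorems.PercNearOneGluingNoHeavyLowerTailSahiE3CovHit
import Literature.Probability.LatticeModels.SahiThirdOrderCorrelation
import Mathlib.Combinatorics.SetFamily.FourFunctions
import Mathlib.Data.Fintype.Pi
import Mathlib.Order.Irreducible
import Mathlib.Tactic.Linarith
import Mathlib.Tactic.Ring
import Mathlib.Tactic.Positivity
import HarnessLib
import HarnessLib.Audit

/-!
# `NoHeavyLowerTail` (crux stmt-CriticalPhenomena-4575), Sahi programme P4 (Holley / monotone coupling):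
# FKG slot-locality for hitting sets in the ATTRIBUTION REGIME — Sahi's `C₃` for `(↑j₁ ∪ … ∪ ↑j_k, A, B)` under every
# FKG measure whose "first-generator" blocks are not too heavy (all product measures, and more)

Support file (cell `prim-l12`, seat P4, generation 7; `--supports stmt-CriticalPhenomena-4575`).  No named facts, no sorries;
standard axioms; def-free.

## The theorem (new)

`L` finite distributive lattice, `μ ≥ 0` log-supermodular (zeros allowed, `Z = m(L)`), `A, B` up-sets, `j : ι → L` join-primes indexed
by a finite linear order, `U = {x | ∃ i, j i ≤ x}`.  Fibres of the pattern map `x ↦ (j i ≤ x)_i`: `F_t`; bottom fibre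
`F_⊥ = L ∖ U`; atom fibres `F_{e_i} = {x | j i ≤ x, j l ≰ x (l ≠ i)}` ("exactly the generator `j i`"); attribution blocks
`B_i = {x | j i ≤ x, j l ≰ x (l < i)}` ("the first generator below `x` is `j i`"), a partition of `U`.

  `latticeE3_nonneg_hit_of_attribution`:  if  `m(F_⊥)·m(B_i) ≤ (Z + m(F_⊥))·m(F_{e_i})`  for every `i`  (ATT),
  then `0 ≤ latticeE3 μ U A B` — Sahi's `Z³ E₃(1_U, 1_A, 1_B) ≥ 0`.

(ATT) says that the pattern certificate may be placed on the atoms of the pattern: `T_{e_i} = Z·m(F_⊥)·m(B_i)` satisfies (T0), (T1)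
[= (ATT)], (TΣ) [the blocks partition `U`], (Ti) [`B_i ⊆ π⁻¹(S)` when `e_i ∈ S`] and (Tii) [the quantitative FKG inequality
`cov_upperSet_ge_mass_mul`: `m(F_⊥)·m(⋃_{e_i ∈ S∩S'} ↑j_i) ≤ Z·m(Ŝ ∩ Ŝ') − m(Ŝ)·m(Ŝ')`, a strengthening of `…SahiE3CovHit` with the
whole bottom fibre in place of `μ(⊥)`], so `…SahiE3HitSlotCertificate.latticeE3_nonneg_of_certificate` applies.  Every product measure
on `2^κ` with `U = {ω | ω ∩ R ≠ ∅}` satisfies (ATT) for any enumeration of `R` (`m(B_i)/m(F_{e_i}) = 1/∏_{l>i} q_l ≤ 1/m(∅)`), so this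
contains the product-measure hitting-slot theorem of cell P3 (`SahiHittingSlot.sahiE_three_hit_nonneg`) and extends it to all FKG
measures close enough to the atoms regime, on every finite distributive lattice; the general FKG case is the open "ρ-lemma"
(existence of a certificate for every FKG pattern measure; HOME prim-l12-p4/RHO-LEMMA-gen6.md and the gen-7 memo).
-/

namespace Summit.CriticalPhenomena.PercolationContinuityZ3.Theorems.SahiE3HitSlotAttribution

open Finset Literature.Probability.LatticeModels SahiE3HitSlotCertificate
open scoped BigOperators

variable {α : Type*} [DistribLattice α] [Fintype α] [DecidableEq α]

/-! ### A quantitative FKG inequality: `m(K)·m(H) ≤ Z·m(S ∩ S') − m(S)·m(S')` -/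

/-- **Quantitative FKG.**  `μ ≥ 0` log-supermodular on a finite distributive lattice; `S, S'` up-sets; `H ⊆ S ∩ S'` an up-set whose
complement is closed under `⊔` (e.g. a union of principal up-sets of join-primes); `K` any set of points outside `S ∪ S'`.  Then
`m(K)·m(H) ≤ Z·m(S ∩ S') − m(S)·m(S')`.  (`…SahiE3CovHit.cov_upperSet_ge_bot_mul` is the case `K = {⊥}`.) [this work] -/
theorem cov_upperSet_ge_mass_mul {μ : α → ℝ} (hμ₀ : 0 ≤ μ) (hμ : ∀ a b, μ a * μ b ≤ μ (a ⊓ b) * μ (a ⊔ b))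
    {S S' H K : Finset α} (hS : IsUpperSet (S : Set α)) (hS' : IsUpperSet (S' : Set α))
    (hH : IsUpperSet (H : Set α)) (hHS : H ⊆ S) (hHS' : H ⊆ S')
    (hD : ∀ x y, x ∉ H → y ∉ H → x ⊔ y ∉ H) (hKS : ∀ x ∈ K, x ∉ S) (hKS' : ∀ x ∈ K, x ∉ S') :
    mass μ K * mass μ H ≤ mass μ univ * mass μ (S ∩ S') - mass μ S * mass μ S' := by
  set D : Finset α := univ \ H with hDdef
  have memD : ∀ x, x ∈ D ↔ x ∉ H := fun x => by simp [hDdef]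
  have hDinf : ∀ x y, x ∈ D → x ⊓ y ∈ D := by
    intro x y hx
    rw [memD] at hx ⊢
    exact fun h => hx (hH (show x ⊓ y ≤ x from inf_le_left) h)
  -- FKG on the sublattice `D`
  have fkgD : mass μ (S ∩ D) * mass μ (S' ∩ D) ≤ mass μ D * mass μ (S ∩ S' ∩ D) := by
    refine SahiE3CovHit.mass_mul_mass_le' hμ₀ hμ fun x hx y hy => ?_
    rw [Finset.mem_inter] at hx hy
    refine ⟨hDinf x y hx.2, ?_⟩
    rw [Finset.mem_inter, Finset.mem_inter]
    exact ⟨⟨hS (show x ≤ x ⊔ y from le_sup_left) hx.1, hS' (show y ≤ x ⊔ y from le_sup_right) hy.1⟩,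
      (memD _).2 (hD x y ((memD x).1 hx.2) ((memD y).1 hy.2))⟩
  -- mass decompositions along `univ = H ⊔ D`
  have hdisj : ∀ X : Finset α, Disjoint (X ∩ H) (X ∩ D) := by
    intro X
    rw [Finset.disjoint_left]
    intro x hx hx'
    rw [Finset.mem_inter] at hx hx'
    exact ((memD x).1 hx'.2) hx.2
  have hsplit : ∀ X : Finset α, mass μ X = mass μ (X ∩ H) + mass μ (X ∩ D) := by
    intro X
    rw [← SahiE3CovHit.mass_union_of_disjoint μ (hdisj X)]
    congr 1
    ext x
    simp only [Finset.mem_union, Finset.mem_inter, memD]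
    tauto
  have eS : mass μ S = mass μ H + mass μ (S ∩ D) := by rw [hsplit S, Finset.inter_eq_right.2 hHS]
  have eS' : mass μ S' = mass μ H + mass μ (S' ∩ D) := by rw [hsplit S', Finset.inter_eq_right.2 hHS']
  have eSS' : mass μ (S ∩ S') = mass μ H + mass μ (S ∩ S' ∩ D) := by
    rw [hsplit (S ∩ S'), Finset.inter_eq_right.2 (Finset.subset_inter hHS hHS')]
  have eZ : mass μ univ = mass μ H + mass μ D := by rw [hsplit univ, Finset.univ_inter, Finset.univ_inter]
  -- `m(D) ≥ m(S ∩ D) + m(S' ∩ D) − m(S ∩ S' ∩ D) + m(K)`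
  have hincl : mass μ ((S ∩ D) ∪ (S' ∩ D)) + mass μ (S ∩ S' ∩ D) = mass μ (S ∩ D) + mass μ (S' ∩ D) := by
    have e : S ∩ S' ∩ D = (S ∩ D) ∩ (S' ∩ D) := by ext x; simp only [Finset.mem_inter]; tauto
    rw [e]; unfold mass; exact Finset.sum_union_inter
  have hKdisj : Disjoint K ((S ∩ D) ∪ (S' ∩ D)) := by
    rw [Finset.disjoint_left]
    intro x hxK hx
    rw [Finset.mem_union, Finset.mem_inter, Finset.mem_inter] at hx
    rcases hx with h | h
    · exact hKS x hxK h.1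
    · exact hKS' x hxK h.1
  have hsub : K ∪ ((S ∩ D) ∪ (S' ∩ D)) ⊆ D := by
    intro x hx
    rw [Finset.mem_union, Finset.mem_union, Finset.mem_inter, Finset.mem_inter] at hx
    rcases hx with hx | h | h
    · exact (memD x).2 fun hxH => hKS x hx (hHS hxH)
    · exact h.2
    · exact h.2
  have hDge : mass μ K + mass μ ((S ∩ D) ∪ (S' ∩ D)) ≤ mass μ D := by
    rw [← SahiE3CovHit.mass_union_of_disjoint μ hKdisj]; exact mass_mono hμ₀ hsub
  have hH0 : 0 ≤ mass μ H := mass_nonneg hμ₀ H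
  rw [eS, eS', eSS', eZ]
  nlinarith [fkgD, hincl, hDge, hH0, mul_le_mul_of_nonneg_left hDge hH0]

/-! ### The pattern map, its preimages and the attribution blocks -/

section Pattern

variable [DecidableLE α] {ι : Type*} [Fintype ι] [DecidableEq ι]

omit [Fintype α] [DecidableEq α] [Fintype ι] [DecidableEq ι] in
/-- The pattern map `x ↦ (j i ≤ x)_i` is monotone. [this work] -/
theorem pat_mono (j : ι → α) {x y : α} (hxy : x ≤ y) :
    (fun i => decide (j i ≤ x)) ≤ fun i => decide (j i ≤ y) := by
  intro i
  by_cases h : j i ≤ x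
  · simp [h, le_trans h hxy]
  · simp [h]

omit [DecidableEq α] [DecidableEq ι] in
/-- The preimage of an up-set of patterns is an up-set. [this work] -/
theorem isUpperSet_preimage (j : ι → α) {S : Finset (ι → Bool)} (hS : IsUpperSet (S : Set (ι → Bool))) :
    IsUpperSet ((univ.filter fun x : α => (fun i => decide (j i ≤ x)) ∈ S : Finset α) : Set α) := by
  intro x y hxy hx
  rw [Finset.mem_coe, Finset.mem_filter] at hx ⊢
  exact ⟨Finset.mem_univ _, hS (pat_mono j hxy) hx.2⟩

omit [DecidableEq ι] in
/-- `Σ_{t ∈ S} m(F_t) = m(π⁻¹ S)`. [this work] -/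
theorem sum_mass_fib_eq (μ : α → ℝ) {j : ι → α} {F : (ι → Bool) → Finset α}
    (hF : ∀ (t : ι → Bool) (x : α), x ∈ F t ↔ ∀ i, (j i ≤ x ↔ t i = true)) (S : Finset (ι → Bool)) :
    ∑ t ∈ S, mass μ (F t) = mass μ (univ.filter fun x : α => (fun i => decide (j i ≤ x)) ∈ S) := by
  have e : ∀ t, F t = univ.filter fun x : α => (fun i => decide (j i ≤ x)) = t := by
    intro t; rw [← Finset.univ_inter (F t)]; exact inter_fib_eq_filter hF univ t
  unfold mass
  simp_rw [e]
  exact Finset.sum_fiberwise_eq_sum_filter univ S (fun x : α => fun i => decide (j i ≤ x)) μ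

omit [Fintype α] [DecidableEq α] [Fintype ι] in
/-- A point above `j i` has pattern above the atom `e_i`. [this work] -/
theorem atom_le_pat (j : ι → α) {x : α} {i : ι} (hx : j i ≤ x) :
    (fun l => decide (l = i)) ≤ fun l => decide (j l ≤ x) := by
  intro l
  by_cases h : l = i
  · subst h; simp [hx]
  · simp [h]

omit [DistribLattice α] [Fintype α] [DecidableEq α] [DecidableLE α] [Fintype ι] in
/-- The atom patterns are not `⊥`. [this work] -/
theorem atom_ne_bot (i : ι) : (fun l => decide (l = i)) ≠ (⊥ : ι → Bool) := by
  intro h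
  have := congrFun h i
  simp at this

omit [DistribLattice α] [Fintype α] [DecidableEq α] [DecidableLE α] [Fintype ι] in
/-- The atom patterns are distinct. [this work] -/
theorem atom_injective {i i' : ι} (h : (fun l => decide (l = i)) = fun l => decide (l = i')) : i = i' := by
  have := congrFun h i
  simpa using this

omit [DistribLattice α] [Fintype α] [DecidableEq α] [DecidableLE α] in
/-- `Σ_{i'} [e_i = e_{i'}]·c_{i'} = c_i`. [this work] -/
theorem sum_ite_atom_eq (c : ι → ℝ) (i : ι) :
    (∑ i', if (fun l => decide (l = i)) = (fun l => decide (l = i')) then c i' else 0) = c i := by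
  rw [Finset.sum_eq_single i]
  · simp
  · intro i' _ hne
    rw [if_neg]
    exact fun e => hne (atom_injective e).symm
  · simp

omit [DistribLattice α] [Fintype α] [DecidableEq α] [DecidableLE α] in
/-- `Σ_i [t = e_i]·c_i = 0` off the atoms. [this work] -/
theorem sum_ite_atom_eq_zero (c : ι → ℝ) {t : ι → Bool} (ht : ∀ i, t ≠ fun l => decide (l = i)) :
    (∑ i, if t = (fun l => decide (l = i)) then c i else 0) = 0 :=
  Finset.sum_eq_zero fun i _ => if_neg (ht i)

omit [DistribLattice α] [Fintype α] [DecidableEq α] [DecidableLE α] in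
/-- `Σ_i [t = e_i]·c_i ≥ 0` for `c ≥ 0`. [this work] -/
theorem sum_ite_atom_nonneg {c : ι → ℝ} (hc : ∀ i, 0 ≤ c i) (t : ι → Bool) :
    0 ≤ ∑ i, if t = (fun l => decide (l = i)) then c i else 0 :=
  Finset.sum_nonneg fun i _ => by split_ifs <;> simp [hc i]

omit [DecidableEq ι] in
/-- The blocks `B_i` partition the hitting set: `m(U) = Σ_i m(B_i)`. [this work] -/
theorem mass_hit_eq_sum_blocks [LinearOrder ι] (μ : α → ℝ) (j : ι → α) :
    mass μ (univ.filter fun x : α => ∃ i, j i ≤ x) =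
      ∑ i, mass μ (univ.filter fun x : α => j i ≤ x ∧ ∀ l, l < i → ¬ j l ≤ x) := by
  have hdisj : Set.PairwiseDisjoint (↑(univ : Finset ι))
      (fun i => univ.filter fun x : α => j i ≤ x ∧ ∀ l, l < i → ¬ j l ≤ x) := by
    intro i _ i' _ hne
    rw [Function.onFun, Finset.disjoint_left]
    intro x hx hx'
    rw [Finset.mem_filter] at hx hx'
    rcases lt_or_gt_of_ne hne with h | h
    · exact hx'.2.2 i h hx.2.1
    · exact hx.2.2 i' h hx'.2.1
  have e : (univ.filter fun x : α => ∃ i, j i ≤ x) =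
      (univ : Finset ι).biUnion fun i => univ.filter fun x : α => j i ≤ x ∧ ∀ l, l < i → ¬ j l ≤ x := by
    ext x
    simp only [Finset.mem_filter, Finset.mem_univ, true_and, Finset.mem_biUnion]
    constructor
    · rintro ⟨i₀, hi₀⟩
      obtain ⟨i, hi, hmin⟩ := Finset.exists_min_image (univ.filter fun i => j i ≤ x) id ⟨i₀, by simp [hi₀]⟩
      rw [Finset.mem_filter] at hi
      refine ⟨i, hi.2, fun l hl hjl => ?_⟩
      have := hmin l (by simp [hjl])
      exact absurd this (not_le.2 hl)
    · rintro ⟨i, hi, -⟩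
      exact ⟨i, hi⟩
  rw [e]; unfold mass; rw [Finset.sum_biUnion hdisj]

end Pattern

/-! ### The theorem -/

/-- **Sahi's `C₃` for a hitting-set slot under every FKG measure in the attribution regime.**  `μ ≥ 0` log-supermodular on a
finite distributive lattice, `j : ι → α` join-primes (finite linear order `ι`), fibres `F_t` of `x ↦ (j i ≤ x)_i`, `A, B` up-sets.
If `m(F_⊥)·m(B_i) ≤ (Z + m(F_⊥))·m(F_{e_i})` for every `i` (blocks `B_i = {x | j i ≤ x, ∀ l < i, j l ≰ x}`, atoms
`e_i = (l = i)_l`), then `0 ≤ latticeE3 μ {x | ∃ i, j i ≤ x} A B`. [this work] -/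
theorem latticeE3_nonneg_hit_of_attribution [DecidableLE α] {ι : Type*} [Fintype ι] [DecidableEq ι] [LinearOrder ι]
    {μ : α → ℝ} (hμ₀ : 0 ≤ μ) (hμ : ∀ a b, μ a * μ b ≤ μ (a ⊓ b) * μ (a ⊔ b)) {j : ι → α} (hj : ∀ i, SupPrime (j i))
    {F : (ι → Bool) → Finset α} (hF : ∀ (t : ι → Bool) (x : α), x ∈ F t ↔ ∀ i, (j i ≤ x ↔ t i = true))
    {A B : Finset α} (hA : IsUpperSet (A : Set α)) (hB : IsUpperSet (B : Set α))
    (hatt : ∀ i, mass μ (F ⊥) * mass μ (univ.filter fun x : α => j i ≤ x ∧ ∀ l, l < i → ¬ j l ≤ x) ≤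
      (mass μ univ + mass μ (F ⊥)) * mass μ (F fun l => decide (l = i))) :
    0 ≤ latticeE3 μ (univ.filter fun x => ∃ i, j i ≤ x) A B := by
  -- notation
  set Z : ℝ := mass μ univ with hZ
  set ν : (ι → Bool) → ℝ := fun t => mass μ (F t) with hν
  set blk : ι → ℝ := fun i => mass μ (univ.filter fun x : α => j i ≤ x ∧ ∀ l, l < i → ¬ j l ≤ x) with hblk
  set T : (ι → Bool) → ℝ := fun t => Z * ν ⊥ * ∑ i, if t = (fun l => decide (l = i)) then blk i else 0 with hT
  have hZ0 : 0 ≤ Z := mass_nonneg hμ₀ _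
  have hν0 : ∀ t, 0 ≤ ν t := fun t => mass_nonneg hμ₀ _
  have hblk0 : ∀ i, 0 ≤ blk i := fun i => mass_nonneg hμ₀ _
  have sν : ∑ s, ν s = Z := by
    rw [hZ, mass_eq_sum_fib μ hF univ]; exact Finset.sum_congr rfl fun t _ => by rw [Finset.univ_inter]
  -- points of the bottom fibre have pattern `⊥`, points of `B_i` have pattern `≥ e_i`
  have pat_bot : ∀ x ∈ F ⊥, (fun i => decide (j i ≤ x)) = ⊥ := by
    intro x hx
    rw [hF] at hx
    funext i
    have : ¬ j i ≤ x := fun h => Bool.false_ne_true ((hx i).1 h)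
    simp [this]
  have hTsumS : ∀ S : Finset (ι → Bool), ∑ t ∈ S, T t =
      Z * ν ⊥ * ∑ i ∈ univ.filter (fun i => (fun l => decide (l = i)) ∈ S), blk i := by
    intro S
    rw [hT]; simp only
    rw [← Finset.mul_sum, Finset.sum_comm]
    congr 1
    rw [Finset.sum_filter]
    refine Finset.sum_congr rfl fun i _ => ?_
    rw [Finset.sum_ite_eq' S (fun l => decide (l = i)) (fun _ => blk i)]
  -- blocks inside preimages
  have blocks_le : ∀ S : Finset (ι → Bool), IsUpperSet (S : Set (ι → Bool)) →
      ∑ i ∈ univ.filter (fun i => (fun l => decide (l = i)) ∈ S), blk i ≤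
        mass μ ((univ.filter fun i => (fun l => decide (l = i)) ∈ S).biUnion fun i => principalUp (j i)) ∧
      ((univ.filter fun i => (fun l => decide (l = i)) ∈ S).biUnion fun i => principalUp (j i)) ⊆
        univ.filter fun x : α => (fun i => decide (j i ≤ x)) ∈ S := by
    intro S hS
    constructor
    · have hdisj : Set.PairwiseDisjoint (↑(univ.filter fun i => (fun l => decide (l = i)) ∈ S))
          (fun i => univ.filter fun x : α => j i ≤ x ∧ ∀ l, l < i → ¬ j l ≤ x) := by
        intro i _ i' _ hne
        rw [Function.onFun, Finset.disjoint_left]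
        intro x hx hx'
        rw [Finset.mem_filter] at hx hx'
        rcases lt_or_gt_of_ne hne with h | h
        · exact hx'.2.2 i h hx.2.1
        · exact hx.2.2 i' h hx'.2.1
      have e : ∑ i ∈ univ.filter (fun i => (fun l => decide (l = i)) ∈ S), blk i =
          mass μ ((univ.filter fun i => (fun l => decide (l = i)) ∈ S).biUnion
            fun i => univ.filter fun x : α => j i ≤ x ∧ ∀ l, l < i → ¬ j l ≤ x) := by
        rw [hblk]; unfold mass; rw [Finset.sum_biUnion hdisj]
      rw [e]
      refine mass_mono hμ₀ (Finset.biUnion_subset_biUnion_of_subset_left _ Subset.rfl |>.trans ?_)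
      refine Finset.biUnion_mono fun i _ => ?_
      intro x hx
      rw [Finset.mem_filter] at hx
      exact mem_principalUp.2 hx.2.1
    · intro x hx
      rw [Finset.mem_biUnion] at hx
      obtain ⟨i, hi, hix⟩ := hx
      rw [Finset.mem_filter] at hi ⊢
      exact ⟨Finset.mem_univ _, hS (atom_le_pat j (mem_principalUp.1 hix)) hi.2⟩
  refine latticeE3_nonneg_of_certificate hμ₀ hμ hj hF hA hB ν (fun t => rfl) T ?_ ?_ ?_ ?_ ?_
  · -- (T0)
    intro t _
    rw [hT]; simp only
    exact mul_nonneg (mul_nonneg hZ0 (hν0 ⊥)) (sum_ite_atom_nonneg hblk0 t)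
  · -- (T1) = (ATT)
    intro t _
    rw [sν, hT]
    simp only
    by_cases h : ∃ i, t = fun l => decide (l = i)
    · obtain ⟨i, rfl⟩ := h
      rw [sum_ite_atom_eq]
      have := hatt i
      calc Z * ν ⊥ * blk i = Z * (mass μ (F ⊥) * blk i) := by rw [hν]; ring
        _ ≤ Z * ((Z + ν ⊥) * ν fun l => decide (l = i)) := mul_le_mul_of_nonneg_left this hZ0
        _ = Z * (ν fun l => decide (l = i)) * (Z + ν ⊥) := by ring
    · rw [sum_ite_atom_eq_zero blk fun i e => h ⟨i, e⟩, mul_zero]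
      exact mul_nonneg (mul_nonneg hZ0 (hν0 t)) (add_nonneg hZ0 (hν0 ⊥))
  · -- (TΣ): the blocks partition `U`
    rw [hTsumS, sν]
    have e1 : (univ.filter fun i => (fun l => decide (l = i)) ∈ univ.erase (⊥ : ι → Bool)) = univ := by
      ext i; simp [atom_ne_bot i]
    have e2 : ∑ t ∈ univ.erase ⊥, ν t = mass μ (univ.filter fun x : α => ∃ i, j i ≤ x) := by
      rw [← Finset.inter_univ (univ.filter fun x : α => ∃ i, j i ≤ x), mass_hit_inter_eq μ hF univ]
      exact Finset.sum_congr rfl fun t _ => by rw [Finset.univ_inter]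
    rw [e1, e2, mass_hit_eq_sum_blocks μ j]
  · -- (Ti): `B_i ⊆ π⁻¹ S` for `e_i ∈ S`
    intro S hS _
    rw [hTsumS, sν, sum_mass_fib_eq μ hF S]
    obtain ⟨h1, h2⟩ := blocks_le S hS
    exact mul_le_mul_of_nonneg_left (h1.trans (mass_mono hμ₀ h2)) (mul_nonneg hZ0 (hν0 ⊥))
  · -- (Tii): the quantitative FKG inequality with `K = F_⊥`
    intro S S' hS hS' hbS hbS'
    have hSS' : IsUpperSet ((S ∩ S' : Finset (ι → Bool)) : Set (ι → Bool)) := by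
      rw [Finset.coe_inter]; exact hS.inter hS'
    rw [hTsumS, sν, sum_mass_fib_eq μ hF S, sum_mass_fib_eq μ hF S', sum_mass_fib_eq μ hF (S ∩ S')]
    obtain ⟨h1, h2⟩ := blocks_le (S ∩ S') hSS'
    set I := univ.filter fun i => (fun l => decide (l = i)) ∈ S ∩ S' with hI
    set H := I.biUnion fun i => principalUp (j i) with hH
    set PS := univ.filter fun x : α => (fun i => decide (j i ≤ x)) ∈ S with hPS
    set PS' := univ.filter fun x : α => (fun i => decide (j i ≤ x)) ∈ S' with hPS'
    have ePSS' : (univ.filter fun x : α => (fun i => decide (j i ≤ x)) ∈ S ∩ S') = PS ∩ PS' := by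
      ext x; simp [hPS, hPS']
    rw [ePSS'] at h2 ⊢
    have eH : H = (I.image j).biUnion principalUp := by rw [hH, Finset.image_biUnion]
    have hcov : mass μ (F ⊥) * mass μ H ≤ Z * mass μ (PS ∩ PS') - mass μ PS * mass μ PS' := by
      refine cov_upperSet_ge_mass_mul hμ₀ hμ (isUpperSet_preimage j hS) (isUpperSet_preimage j hS') ?_
        (h2.trans Finset.inter_subset_left) (h2.trans Finset.inter_subset_right) ?_ ?_ ?_
      · rw [eH]; exact SahiE3CovHit.isUpperSet_biUnion_principalUp _
      · intro x y hx hy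
        rw [eH] at hx hy ⊢
        refine SahiE3CovHit.sup_notMem_biUnion_principalUp (fun j' hj' => ?_) hx hy
        obtain ⟨i, -, rfl⟩ := Finset.mem_image.1 hj'
        exact hj i
      · intro x hx hxS
        rw [hPS, Finset.mem_filter, pat_bot x hx] at hxS
        exact hbS hxS.2
      · intro x hx hxS'
        rw [hPS', Finset.mem_filter, pat_bot x hx] at hxS'
        exact hbS' hxS'.2
    have hH0 : 0 ≤ mass μ H := mass_nonneg hμ₀ _
    have hcov0 : 0 ≤ Z * mass μ (PS ∩ PS') - mass μ PS * mass μ PS' :=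
      le_trans (mul_nonneg (hν0 ⊥) hH0) hcov
    calc Z * ν ⊥ * ∑ i ∈ I, blk i ≤ Z * (ν ⊥ * mass μ H) := by
          rw [mul_assoc]; exact mul_le_mul_of_nonneg_left (mul_le_mul_of_nonneg_left h1 (hν0 ⊥)) hZ0
      _ ≤ Z * (Z * mass μ (PS ∩ PS') - mass μ PS * mass μ PS') := mul_le_mul_of_nonneg_left hcov hZ0
      _ ≤ (Z + ν ⊥) * (Z * mass μ (PS ∩ PS') - mass μ PS * mass μ PS') := by nlinarith [hν0 ⊥]

/-! ### Boolean lattices: the slot "`ω` meets `{v i}`" -/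

section Boolean

variable {κ : Type*} [Fintype κ] [DecidableEq κ] {ι : Type*} [Fintype ι] [DecidableEq ι] [LinearOrder ι]

/-- **Sahi's `C₃` on `2^κ` for a hitting-set slot `{ω | ∃ i, v i ∈ ω}` under every FKG weight in the attribution regime**:
with `F_t = {ω | ∀ i, v i ∈ ω ↔ t i}` the pattern fibres and `B_i = {ω | v i ∈ ω, v l ∉ ω (l < i)}` the first-hit blocks, if
`m(F_⊥)·m(B_i) ≤ (Z + m(F_⊥))·m(F_{e_i})` for all `i` then `0 ≤ latticeE3 μ {ω | ∃ i, v i ∈ ω} A B` for all up-sets `A, B`.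
(Product measures satisfy the hypothesis for every enumeration `v`; cf. cell P3's `SahiHittingSlot.sahiE_three_hit_nonneg`.)
[this work] -/
theorem latticeE3_nonneg_hitting_of_attribution {μ : Finset κ → ℝ} (hμ₀ : 0 ≤ μ)
    (hμ : ∀ a b, μ a * μ b ≤ μ (a ⊓ b) * μ (a ⊔ b)) (v : ι → κ)
    {F : (ι → Bool) → Finset (Finset κ)} (hF : ∀ (t : ι → Bool) (ω : Finset κ), ω ∈ F t ↔ ∀ i, (v i ∈ ω ↔ t i = true))
    {A B : Finset (Finset κ)} (hA : IsUpperSet (A : Set (Finset κ))) (hB : IsUpperSet (B : Set (Finset κ)))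
    (hatt : ∀ i, mass μ (F ⊥) * mass μ (univ.filter fun ω : Finset κ => v i ∈ ω ∧ ∀ l, l < i → v l ∉ ω) ≤
      (mass μ univ + mass μ (F ⊥)) * mass μ (F fun l => decide (l = i))) :
    0 ≤ latticeE3 μ (univ.filter fun ω : Finset κ => ∃ i, v i ∈ ω) A B := by
  have hj : ∀ i, SupPrime ({v i} : Finset κ) := fun i => SahiE3CovHit.supPrime_singleton' (v i)
  have hF' : ∀ (t : ι → Bool) (ω : Finset κ), ω ∈ F t ↔ ∀ i, (({v i} : Finset κ) ≤ ω ↔ t i = true) := by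
    intro t ω; rw [hF]; simp only [Finset.singleton_subset_iff]
  have eU : (univ.filter fun ω : Finset κ => ∃ i, v i ∈ ω) = univ.filter fun ω : Finset κ => ∃ i, ({v i} : Finset κ) ≤ ω := by
    ext ω; simp
  have eB : ∀ i, (univ.filter fun ω : Finset κ => v i ∈ ω ∧ ∀ l, l < i → v l ∉ ω) =
      univ.filter fun ω : Finset κ => ({v i} : Finset κ) ≤ ω ∧ ∀ l, l < i → ¬ ({v l} : Finset κ) ≤ ω := by
    intro i; ext ω; simp
  rw [eU]
  refine latticeE3_nonneg_hit_of_attribution hμ₀ hμ hj hF' hA hB fun i => ?_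
  rw [← eB i]; exact hatt i

end Boolean

end Summit.CriticalPhenomena.PercolationContinuityZ3.Theorems.SahiE3HitSlotAttribution
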